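import Literature.MathematicalPhysics.QuantumLattice.PairFieldCommutatorLocalityTT
import Literature.MathematicalPhysics.QuantumLattice.ApproximateEigenvectorLemmas
import HarnessLib

/-!
# Vector-norm bounds for the pair field: `‖Δ_g† φ‖ ≤ C·L²‖φ‖` and `‖[H^{tt'}_L, Δ_g†] φ‖ ≤ C·L²‖φ‖`

Topic `Literature/MathematicalPhysics/QuantumLattice`; companion of `PairFieldCommutatorLocality(TT).lean`
(FORM bounds `|⟨ψ,[Δ,Δ†]ψ⟩|`, `‖⟨ψ,[O,[H,O]]ψ⟩‖ ≤ C·L²` in unit vectors). Here the two remaining inputs of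
the Koma–Tasaki TOWER argument (J. Stat. Phys. 76 (1994) 745, §4: `‖O‖ ≤ oN`, `‖[h_x, O]‖ ≤ 2rho`) in
VECTOR-NORM form, which is what the tower norms `‖(Δ†)^m ψ‖` need: for every vector `φ` of the torus Fock
space,
* `eucNorm_fermionEmbed_mulVec_le` — `‖Γ_f(X) φ‖ ≤ (Σ_{s,t} ‖X_{st}‖)·‖φ‖` (matrix units embed as
  contractions: `Γ(|s⟩⟨t|)⋆Γ(|s⟩⟨t|) = Γ(|t⟩⟨t|)` is a projection);
* `eucNorm_sum_relabel_translate_mulVec_le` — a translation sum `Σ_v T_v Y T_vᴴ` of an operator with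
  `‖Yχ‖ ≤ c‖χ‖` has `‖(Σ_v T_v Y T_vᴴ) φ‖ ≤ L^d·c·‖φ‖`;
* **`exists_eucNorm_pairField_conjTranspose_mulVec_le`** — `‖Δ_g† φ‖ ≤ C·L²·‖φ‖` (`L ≥ L₀`);
* **`exists_eucNorm_commutator_hubbardTorusTT'_pairField_conjTranspose_mulVec_le`** —
  `‖(H^{tt'}_L Δ_g† − Δ_g† H^{tt'}_L) φ‖ ≤ C·L²·‖φ‖` (`L ≥ L₀`): the commutator is the translation sum of
  the embedded LOCAL commutator `[H^{tt'}_{Λ'}, Γ(incl) Φ₀†]` (`hubbardTorusTT'_commutator_sum_relabel_translate`).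
Everything PROVED; no definition, no named fact, no `sorry`.

References: T. Koma, H. Tasaki, J. Stat. Phys. 76 (1994) 745, §4 [KomaTasaki1994]; O. Bratteli,
D. W. Robinson, *Operator Algebras and Quantum Statistical Mechanics 2* (1997), §5.2.2 and Thm. 6.2.4
[BratteliRobinsonII1997].
-/

noncomputable section

namespace Literature.MathematicalPhysics.QuantumLattice

open Matrix Finset HubbardWave0 Literature.Probability.LatticeModels
open scoped ComplexOrder BigOperators

/-! ### Elementary vector-norm facts -/

section VectorNorms

variable {m : Type*} [Fintype m]

/-- Triangle inequality for finite sums of coordinate vectors. [folklore] -/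
private theorem eucNorm_finset_sum_le {ι : Type*} (s : Finset ι) (w : ι → m → ℂ) :
    eucNorm (∑ i ∈ s, w i) ≤ ∑ i ∈ s, eucNorm (w i) := by
  classical
  refine Finset.induction_on s (by simp) fun i s hi ih => ?_
  rw [Finset.sum_insert hi, Finset.sum_insert hi]
  exact (eucNorm_add_le _ _).trans (by linarith)

/-- A contraction does not increase the Euclidean norm: `‖Mv‖₂ ≤ ‖v‖₂` (the `DecidableEq` instance is
taken from the hypothesis, not synthesised). [folklore] -/
private theorem IsContraction.eucNorm_mulVec_le {instD : DecidableEq m} {M : Matrix m m ℂ} (hM : M.IsContraction)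
    (v : m → ℂ) :
    eucNorm (M *ᵥ v) ≤ eucNorm v := by
  have h := (Complex.le_def.1 (hM.star_mulVec_dotProduct_le v)).1
  rw [← eucNorm_sq, ← eucNorm_sq] at h
  exact (pow_le_pow_iff_left₀ (eucNorm_nonneg _) (eucNorm_nonneg _) two_ne_zero).1 h

/-- Unitary conjugation preserves vector-norm bounds: `Uᴴ U = 1`, `‖Xχ‖ ≤ c‖χ‖ ∀χ ⟹ ‖(U X Uᴴ) v‖ ≤ c‖v‖`.
[folklore] -/
private theorem eucNorm_conj_mulVec_le {instD : DecidableEq m} {U X : Matrix m m ℂ} (hU : Uᴴ * U = 1) {c : ℝ}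
    (hX : ∀ χ : m → ℂ, eucNorm (X *ᵥ χ) ≤ c * eucNorm χ) (v : m → ℂ) :
    eucNorm ((U * X * Uᴴ) *ᵥ v) ≤ c * eucNorm v := by
  have hU' : (Uᴴ)ᴴ * Uᴴ = 1 := by rw [conjTranspose_conjTranspose]; exact mul_eq_one_comm.1 hU
  rw [← mulVec_mulVec, ← mulVec_mulVec, eucNorm_mulVec_of_conjTranspose_mul_self hU]
  exact (hX _).trans (by rw [eucNorm_mulVec_of_conjTranspose_mul_self hU'])

end VectorNorms

/-! ### Embedded window operators are bounded by the `ℓ¹` norm of their matrix -/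

section Embedding

variable {Λ₀ Λ₀' : Type*} [LinearOrder Λ₀] [Fintype Λ₀] [LinearOrder Λ₀'] [Fintype Λ₀']

/-- **`‖Γ_f(|s⟩⟨t|) φ‖₂ ≤ ‖φ‖₂`**: the embedded matrix unit is a partial isometry
(`Γ(|s⟩⟨t|)⋆Γ(|s⟩⟨t|) = Γ(|t⟩⟨t|)`, an orthogonal projection). [cite: BratteliRobinsonII1997, §5.2.2] -/
theorem eucNorm_fermionEmbed_single_mulVec_le [DecidableEq (Finset (Orb Λ₀))] (f : Λ₀ ↪ Λ₀')
    (s t : Finset (Orb Λ₀)) (φ : Fock (Orb Λ₀')) :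
    eucNorm (fermionEmbed f (Matrix.single s t (1 : ℂ)) *ᵥ φ) ≤ eucNorm φ := by
  set E := fermionEmbed f (Matrix.single s t (1 : ℂ)) with hE
  set P := fermionEmbed f (Matrix.single t t (1 : ℂ)) with hP
  have hEE : Eᴴ * E = P := by
    rw [hE, ← fermionEmbed_conjTranspose, ← fermionEmbed_mul, conjTranspose_single, star_one,
      single_mul_single_same, mul_one]
  have hPh : Pᴴ = P := by
    rw [hP, ← fermionEmbed_conjTranspose, conjTranspose_single, star_one]
  have hP2 : P * P = P := by
    rw [hP, ← fermionEmbed_mul, single_mul_single_same, mul_one]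
  have hnormE : (star (E *ᵥ φ) ⬝ᵥ (E *ᵥ φ)).re ≤ (star φ ⬝ᵥ φ).re := by
    have h1 : star (E *ᵥ φ) ⬝ᵥ (E *ᵥ φ) = star (P *ᵥ φ) ⬝ᵥ (P *ᵥ φ) := by
      rw [star_mulVec, ← dotProduct_mulVec, mulVec_mulVec, hEE, star_mulVec, ← dotProduct_mulVec,
        mulVec_mulVec, hPh, hP2]
    rw [h1]
    exact re_star_dotProduct_proj_mulVec_le hPh hP2 φ
  rw [← eucNorm_sq, ← eucNorm_sq] at hnormE
  exact (pow_le_pow_iff_left₀ (eucNorm_nonneg _) (eucNorm_nonneg _) two_ne_zero).1 hnormE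

/-- **`‖Γ_f(X) φ‖₂ ≤ (Σ_{s,t} ‖X_{st}‖)·‖φ‖₂`** (expand `X` in matrix units). [cite: BratteliRobinsonII1997, §5.2.2] -/
theorem eucNorm_fermionEmbed_mulVec_le [DecidableEq (Finset (Orb Λ₀))] (f : Λ₀ ↪ Λ₀')
    (X : Matrix (Finset (Orb Λ₀)) (Finset (Orb Λ₀)) ℂ) (φ : Fock (Orb Λ₀')) :
    eucNorm (fermionEmbed f X *ᵥ φ) ≤ (∑ s, ∑ t, ‖X s t‖) * eucNorm φ := by
  have hX : fermionEmbed f X = ∑ s, ∑ t, X s t • fermionEmbed f (Matrix.single s t (1 : ℂ)) := by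
    conv_lhs => rw [matrix_eq_sum_single X]
    rw [map_sum]
    refine Finset.sum_congr rfl fun s _ => ?_
    rw [map_sum]
    refine Finset.sum_congr rfl fun t _ => ?_
    rw [show Matrix.single s t (X s t) = X s t • Matrix.single s t (1 : ℂ) by
      rw [smul_single, smul_eq_mul, mul_one], fermionEmbed_smul]
  rw [hX, sum_mulVec, Finset.sum_mul]
  refine (eucNorm_finset_sum_le _ _).trans (Finset.sum_le_sum fun s _ => ?_)
  rw [sum_mulVec, Finset.sum_mul]
  refine (eucNorm_finset_sum_le _ _).trans (Finset.sum_le_sum fun t _ => ?_)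
  rw [smul_mulVec, eucNorm_smul]
  exact mul_le_mul_of_nonneg_left (eucNorm_fermionEmbed_single_mulVec_le f s t φ) (norm_nonneg _)

end Embedding

/-! ### Translation sums on the torus; the pair field and its commutator with `H^{tt'}` -/

section Torus

variable {d : ℕ} (L : ℕ) [NeZero L]

/-- **Translation sums**: if `‖Yχ‖ ≤ c‖χ‖` for all `χ`, then `‖(Σ_v T_v Y T_vᴴ) φ‖ ≤ L^d·c·‖φ‖`
(`L^d` unitary conjugates). [cite: BratteliRobinsonII1997, Thm. 6.2.4] -/
theorem eucNorm_sum_relabel_translate_mulVec_le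
    {Y : Matrix (Finset (Orb (FermionTorus d L))) (Finset (Orb (FermionTorus d L))) ℂ} {c : ℝ}
    (hY : ∀ χ : Fock (Orb (FermionTorus d L)), eucNorm (Y *ᵥ χ) ≤ c * eucNorm χ)
    (φ : Fock (Orb (FermionTorus d L))) :
    eucNorm ((∑ v : TorusSite d L, relabel (Orb.translate v) Y) *ᵥ φ) ≤ (L : ℝ) ^ d * c * eucNorm φ := by
  rw [sum_mulVec]
  refine (eucNorm_finset_sum_le _ _).trans ?_
  have h : ∀ v ∈ (Finset.univ : Finset (TorusSite d L)),
      eucNorm (relabel (Orb.translate v) Y *ᵥ φ) ≤ c * eucNorm φ := by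
    intro v _
    rw [relabel_eq_fockRelabel_conj]
    exact eucNorm_conj_mulVec_le (fockRelabel_conjTranspose_mul_self (Orb.translate v)) hY φ
  refine (Finset.sum_le_sum h).trans (le_of_eq ?_)
  rw [Finset.sum_const, Finset.card_univ, card_torusSite, nsmul_eq_mul]
  push_cast
  ring

/-- **`‖Δ_g† φ‖₂ ≤ C·L²·‖φ‖₂`** for every vector `φ` and every side `L ≥ L₀`: `Δ_g†` is the translation
sum of the embedded adjoint local pair (`pairField_conjTranspose_eq_sum_relabel_translate`), whose matrix
has an `L`-independent `ℓ¹` norm `C`. The vector-norm form of Koma–Tasaki's `‖O_Λ‖ ≤ oN`.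
[cite: KomaTasaki1994, §4] -/
theorem exists_eucNorm_pairField_conjTranspose_mulVec_le (g : Site 2 → ℝ) :
    ∃ C : ℝ, ∃ L₀ : ℕ, 0 ≤ C ∧ ∀ (L : ℕ) [NeZero L], L₀ ≤ L →
      ∀ φ : Fock (Orb (FermionTorus 2 L)),
        eucNorm ((pairField g L)ᴴ *ᵥ φ) ≤ C * (L : ℝ) ^ 2 * eucNorm φ := by
  classical
  set S : Finset (Site 2) := insert (0 : Site 2) unitSteps with hS
  set ΛA : Finset (Site 2) := pairRegion S 0 with hΛA
  set A : FermionOp ΛA := (localPairAt S g 0)ᴴ with hAdef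
  obtain ⟨L₀, hL₀⟩ := exists_forall_le_injOn_proj ΛA
  refine ⟨∑ s, ∑ t, ‖A s t‖, L₀, Finset.sum_nonneg fun s _ => Finset.sum_nonneg fun t _ => norm_nonneg _,
    fun L _ hL φ => ?_⟩
  have hinj : Set.InjOn (Torus.proj (d := 2) L) ↑ΛA := hL₀ L hL
  rw [pairField_conjTranspose_eq_sum_relabel_translate g L hinj]
  have hY : ∀ χ : Fock (Orb (FermionTorus 2 L)),
      eucNorm (fermionEmbed (PolySite.toTorusEmb L hinj) A *ᵥ χ) ≤ (∑ s, ∑ t, ‖A s t‖) * eucNorm χ :=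
    fun χ => eucNorm_fermionEmbed_mulVec_le _ A χ
  exact (eucNorm_sum_relabel_translate_mulVec_le L hY φ).trans (le_of_eq (by ring))

/-- **`‖(H^{tt'}_L Δ_g† − Δ_g† H^{tt'}_L) φ‖₂ ≤ C·L²·‖φ‖₂`** for every vector `φ` and every side `L ≥ L₀`:
the commutator is the translation sum of the embedded LOCAL commutator `[H^{tt'}_{Λ'}, Γ(incl) Φ₀†]`,
`Λ' = thicken (pairRegion) 1` (`hubbardTorusTT'_commutator_sum_relabel_translate`), an `L`-independent
window matrix. The vector-norm form of Koma–Tasaki's `‖[h_x, O]‖ ≤ 2rho` summed over `x`.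
[cite: KomaTasaki1994, §4] [cite: BratteliRobinsonII1997, Thm. 6.2.4] -/
theorem exists_eucNorm_commutator_hubbardTorusTT'_pairField_conjTranspose_mulVec_le
    (g : Site 2 → ℝ) (t t' U : ℝ) :
    ∃ C : ℝ, ∃ L₀ : ℕ, 0 ≤ C ∧ ∀ (L : ℕ) [NeZero L], L₀ ≤ L →
      ∀ φ : Fock (Orb (FermionTorus 2 L)),
        eucNorm ((hubbardTorusTT' L t t' U * (pairField g L)ᴴ -
            (pairField g L)ᴴ * hubbardTorusTT' L t t' U) *ᵥ φ) ≤ C * (L : ℝ) ^ 2 * eucNorm φ := by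
  classical
  set S : Finset (Site 2) := insert (0 : Site 2) unitSteps with hS
  set ΛA : Finset (Site 2) := pairRegion S 0 with hΛA
  set A : FermionOp ΛA := (localPairAt S g 0)ᴴ with hAdef
  set Λ' : Finset (Site 2) := thicken ΛA 1 with hΛ'
  have hAΛ' : ΛA ⊆ Λ' := subset_thicken ΛA 1
  have h8 : thicken ΛA 1 ⊆ Λ' := subset_of_eq rfl
  set Cloc : FermionOp Λ' := (hubbardTTPrimeFermionInteraction t t' U).localHamiltonian Λ' *
      fermionEmbed (PolySite.incl hAΛ') A -
    fermionEmbed (PolySite.incl hAΛ') A * (hubbardTTPrimeFermionInteraction t t' U).localHamiltonian Λ' with hCloc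
  obtain ⟨L₃, hL₃⟩ := exists_forall_le_injOn_proj (thicken Λ' 1)
  refine ⟨∑ s, ∑ t, ‖Cloc s t‖, L₃, Finset.sum_nonneg fun s _ => Finset.sum_nonneg fun t _ => norm_nonneg _,
    fun L _ hL φ => ?_⟩
  have hTinj : Set.InjOn (Torus.proj (d := 2) L) ↑(thicken Λ' 1) := hL₃ L hL
  have hAinj : Set.InjOn (Torus.proj (d := 2) L) ↑ΛA :=
    hTinj.mono (by exact_mod_cast hAΛ'.trans (subset_thicken Λ' 1))
  have hO1 : (pairField g L)ᴴ = ∑ v : TorusSite 2 L, relabel (Orb.translate v)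
      (fermionEmbed (PolySite.toTorusEmb L hAinj) A) := pairField_conjTranspose_eq_sum_relabel_translate g L hAinj
  have hO2 : (pairField g L)ᴴ = ∑ v : TorusSite 2 L, relabel (Orb.translate v)
      (fermionEmbed (PolySite.toTorusEmb L (hTinj.mono (by exact_mod_cast subset_thicken Λ' 1)))
        (fermionEmbed (PolySite.incl hAΛ') A)) := by
    rw [hO1]
    refine Finset.sum_congr rfl fun v _ => ?_
    rw [fermionEmbed_toTorusEmb_incl]
  rw [hO2, hubbardTorusTT'_commutator_sum_relabel_translate L t t' U hAΛ' h8 hTinj A]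
  have hY : ∀ χ : Fock (Orb (FermionTorus 2 L)),
      eucNorm (fermionEmbed (PolySite.toTorusEmb L (hTinj.mono (by exact_mod_cast subset_thicken Λ' 1)))
        Cloc *ᵥ χ) ≤ (∑ s, ∑ t, ‖Cloc s t‖) * eucNorm χ :=
    fun χ => eucNorm_fermionEmbed_mulVec_le _ Cloc χ
  exact (eucNorm_sum_relabel_translate_mulVec_le L hY φ).trans (le_of_eq (by ring))

end Torus

end Literature.MathematicalPhysics.QuantumLattice

end
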